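import Literature.RingTheory.KTheory.WittRingDiagonalForms
import Literature.RingTheory.KTheory.MilnorKStiefelWhitneyHom
import HarnessLib

/-!
# LEMMA 3.1 for actual diagonal forms: the Stiefel–Whitney invariant `w(⟨a₁, …, a_r⟩) = ∏ (1 + l(aᵢ))` and its
# components `wᵢ` (discriminant `w₁`, Hasse–Witt invariant `w₂`, …) depend only on the ISOMETRY class
# (Milnor, *Algebraic K-theory and quadratic forms*, Invent. Math. 9 (1970), §3)

Family `hodge`, lane `lit-hodgefound` (foundations library; seat `lit-hodgefound-p27`, generation 52, row g52-#10);
topic `RingTheory/KTheory`.  Sequel of `WittRingDiagonalForms` (g52-#8: `diagClass a = ∑ (aᵢ) ∈ Ŵ(F)` is an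
isometry invariant, by Witt's chain equivalence of g52-#7), `MilnorKStiefelWhitneyHom` (g41-#2: `swSeries : Ŵ(F) →
k_ΠF`, `swCoeff`, `swSeries_list_sum`, `swCoeff_list_sum`), `MilnorKStiefelWhitneyClasses` (g40-#16: `swComp F i d = wᵢ`)
and `MilnorKStiefelWhitney` (g40-#14: `sw F d = ∏ (1 + l(aᵢ))`, whose invariance was proved only along the abstract
relation `ChainEquiv` of lists).  Milnor's LEMMA 3.1 «The invariant w(M) is a well defined unit in the ring k_ΠF which
depends only on the isomorphism class of M» is obtained here for GENUINE isometry of diagonal forms (`DiagIsometric`,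
equivalently Mathlib's `QuadraticMap.Equivalent` of the `weightedSumSquares`, `char F ≠ 2`): the g40/g41 invariants
`sw`, `swComp i`, `swSeries`, `swCoeff i` of two isometric diagonalisations coincide; in particular the discriminant
`w₁ = l(a₁⋯a_r)` and the Hasse–Witt invariant `w₂ = Σ_{i<j} l(aᵢ)l(aⱼ)` are isometry invariants.  PROVED THEOREMS only;
no definition, no named fact, no instance, no notation, 0 `sorry`, net debt 0 (D-0026).

## The source, verbatim

J. Milnor, *Algebraic K-theory and quadratic forms*, Invent. Math. 9 (1970) 318–344 (held `paper:doi-10-1007-bf01425486`;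
bib key `Milnor1970`), §3 (p0011 L4–L16): «Define the Stiefel-Whitney invariant w(M) ∈ k_ΠF of a quadratic module
M ≅ (a₁) ⊕ ⋯ ⊕ (a_r) by the formula w(M) = (1 + l(a₁))(1 + l(a₂)) ⋯ (1 + l(a_r)). Thus w(M) can be written as
1 + w₁(M) + ⋯ + w_r(M) where wᵢ(M), the i-th Stiefel-Whitney invariant, is equal to the i-th elementary symmetric
function of l(a₁), …, l(a_r). […] Evidently w₁ is just the classical "discriminant" of M, and w₂ is essentially
equal to the classical Hasse-Witt invariant.»  (p0011 L24–L29): «LEMMA 3.1. The invariant w(M) is a well defined unit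
in the ring k_ΠF which depends only on the isomorphism class of M. Furthermore w(M ⊕ N) = w(M) w(N).  Proof. […] In
order to prove that w(M) is well defined, it suffices to consider the rank 2 case. (Compare O'Meara p. 150.)»

## What is formalised (`F` a field, `a : Fin n → Fˣ` the entries of `⟨a₁, …, aₙ⟩`)

* `diagClass_eq_list_sum` (`diagClass a` is the class `∑ (aᵢ)` of the list `List.ofFn a`), **`swSeries_diagClass`**
  (`w(⟨a⟩) = ∏ (1 + l(aᵢ)X)`), **`swCoeff_diagClass`** (`wᵢ(⟨a⟩) = swComp F i ⟨a⟩`), `swComp_one` (`w₁ = l(a₁⋯a_r)`, the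
  discriminant), `swCoeff_one_diagClass`.
* **LEMMA 3.1 for isometry classes** (`char F ≠ 2`): **`swSeries_eq_of_diagIsometric`**, **`swCoeff_eq_of_diagIsometric`**,
  **`swComp_eq_of_diagIsometric`**, **`sw_eq_of_diagIsometric`** (g40's `sw`), `kl_prod_eq_of_diagIsometric` (`w₁`:
  «the classical "discriminant"»), `swComp_two_eq_of_diagIsometric` (`w₂`: «the classical Hasse-Witt invariant»), and
  the `QuadraticMap.Equivalent` forms `swComp_eq_of_equivalent`, `sw_eq_of_equivalent`.
* **«Furthermore w(M ⊕ N) = w(M) w(N)»**: `swSeries_diagClass_append`, `sw_ofFn_append`.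

## References

* [Milnor1970] J. Milnor, *Algebraic K-theory and quadratic forms*, Invent. Math. 9 (1970) 318–344 — §3, definition of
  `w`, `wᵢ` (p0011 L4–L16), Lemma 3.1 (p0011 L24–L29).
* [Knebusch2010] M. Knebusch, *Specialization of Quadratic and Symmetric Bilinear Forms*, Springer 2010 — §1.2 Thm. 1.11
  (through g52-#8).

Provenance: lane `lit-hodgefound`, seat `lit-hodgefound-p27` gen 52 (agent `literature-prover-lit-hodgefound-p27-g52-0`),
row g52-#10.
-/

set_option autoImplicit false

noncomputable section

namespace Literature.RingTheory.KTheory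

open Literature.NumberTheory.QuadraticForms QuadraticMap PowerSeries

section Field

variable (F : Type*) [Field F]

namespace MilnorKStar

open WittGrothendieckRing

/-! ### `w` and `wᵢ` of a diagonal form through its class in `Ŵ(F)` -/

/-- `diagClass a = ∑ (aᵢ)` is the class of the LIST `⟨a₁, …, aₙ⟩` of g40/g41. [cite: Milnor1970, §3 «M ≅ (a₁) ⊕ ⋯ ⊕ (a_r)» (p0011 L4–L5)] -/
theorem diagClass_eq_list_sum {n : ℕ} (a : Fin n → Fˣ) :
    diagClass a = ((List.ofFn a).map (WittGrothendieckRing.gen F)).sum := by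
  rw [diagClass_def, List.map_ofFn, List.sum_ofFn]; rfl

/-- **`w(⟨a₁, …, aₙ⟩) = ∏ (1 + l(aᵢ)X)`** on the class of the diagonal form. [cite: Milnor1970, §3 «w(M) = (1 + l(a₁))(1 + l(a₂)) ⋯ (1 + l(a_r))» (p0011 L4–L9)] -/
theorem swSeries_diagClass {n : ℕ} (a : Fin n → Fˣ) :
    swSeries F (diagClass a) = ((List.ofFn a).map fun c => 1 + C (klc F c) * X).prod := by
  rw [diagClass_eq_list_sum, swSeries_list_sum]

/-- **`wᵢ(⟨a₁, …, aₙ⟩)` is the `i`-th elementary symmetric function `swComp F i` of `l(a₁), …, l(aₙ)`.** [cite: Milnor1970, §3 «wᵢ(M), the i-th Stiefel-Whitney invariant, is equal to the i-th elementary symmetric function of l(a₁), …, l(a_r)» (p0011 L10–L12)] -/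
theorem swCoeff_diagClass (i : ℕ) {n : ℕ} (a : Fin n → Fˣ) :
    swCoeff F i (diagClass a) = toKC F (swComp F i (List.ofFn a)) := by
  rw [diagClass_eq_list_sum, swCoeff_list_sum]

/-- **`w₁ = l(a₁ ⋯ a_r)`: the first Stiefel–Whitney invariant is the discriminant.** [cite: Milnor1970, §3 «Evidently w₁ is just the classical "discriminant" of M» (p0011 L15)] -/
theorem swComp_one (d : List Fˣ) : swComp F 1 d = kl F d.prod := by
  induction d with
  | nil => rw [swComp_succ_nil, List.prod_nil, kl_one]
  | cons c d ih => rw [swComp_succ_cons, ih, swComp_zero, mul_one, List.prod_cons, kl_mul, add_comm]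

/-- `w₁(⟨a₁, …, aₙ⟩) = l(∏ aᵢ)` read in `KC F`. [cite: Milnor1970, §3 (p0011 L15)] -/
theorem swCoeff_one_diagClass {n : ℕ} (a : Fin n → Fˣ) : swCoeff F 1 (diagClass a) = klc F (∏ i, a i) := by
  rw [swCoeff_diagClass, swComp_one, List.prod_ofFn, klc_def]

/-! ### LEMMA 3.1: dependence on the isometry class only -/

variable {F}

/-- **LEMMA 3.1: `w(M) ∈ k_ΠF` depends only on the isometry class of `M`** — for diagonal forms `⟨a⟩ ≅ ⟨b⟩`
(`char F ≠ 2`). [cite: Milnor1970, §3 Lemma 3.1 «The invariant w(M) is a well defined unit in the ring k_ΠF which depends only on the isomorphism class of M» (p0011 L24–L26)] -/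
theorem swSeries_eq_of_diagIsometric (h2 : (2 : F) ≠ 0) {n : ℕ} {a b : Fin n → Fˣ}
    (h : DiagIsometric (fun i => (a i : F)) (fun i => (b i : F))) :
    swSeries F (diagClass a) = swSeries F (diagClass b) := by
  rw [diagClass_eq_of_diagIsometric h2 h]

/-- **LEMMA 3.1 for the components: `wᵢ(M)` depends only on the isometry class.** [cite: Milnor1970, §3 Lemma 3.1 (p0011 L24–L26)] -/
theorem swCoeff_eq_of_diagIsometric (h2 : (2 : F) ≠ 0) (i : ℕ) {n : ℕ} {a b : Fin n → Fˣ}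
    (h : DiagIsometric (fun i => (a i : F)) (fun i => (b i : F))) :
    swCoeff F i (diagClass a) = swCoeff F i (diagClass b) := by
  rw [diagClass_eq_of_diagIsometric h2 h]

/-- **LEMMA 3.1 for g40's elementary symmetric functions: `swComp F i ⟨a⟩ = swComp F i ⟨b⟩` for isometric `⟨a⟩ ≅ ⟨b⟩`.**
[cite: Milnor1970, §3 Lemma 3.1 (p0011 L24–L26)] -/
theorem swComp_eq_of_diagIsometric (h2 : (2 : F) ≠ 0) (i : ℕ) {n : ℕ} {a b : Fin n → Fˣ}
    (h : DiagIsometric (fun i => (a i : F)) (fun i => (b i : F))) :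
    swComp F i (List.ofFn a) = swComp F i (List.ofFn b) := by
  have h' := swCoeff_eq_of_diagIsometric h2 i h
  rw [swCoeff_diagClass, swCoeff_diagClass] at h'
  exact (toKC_bijective F).1 h'

/-- **LEMMA 3.1 for g40's total class `w = ∏ (1 + l(aᵢ)) ∈ k_*F`: `sw F ⟨a⟩ = sw F ⟨b⟩` for isometric `⟨a⟩ ≅ ⟨b⟩`** (there
invariance was proved along the list relation `ChainEquiv`; here for genuine isometry). [cite: Milnor1970, §3 Lemma 3.1 (p0011 L24–L29)] -/
theorem sw_eq_of_diagIsometric (h2 : (2 : F) ≠ 0) {n : ℕ} {a b : Fin n → Fˣ}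
    (h : DiagIsometric (fun i => (a i : F)) (fun i => (b i : F))) :
    sw F (List.ofFn a) = sw F (List.ofFn b) := by
  rw [sw_eq_sum_swComp, sw_eq_sum_swComp, List.length_ofFn, List.length_ofFn]
  exact Finset.sum_congr rfl fun i _ => swComp_eq_of_diagIsometric h2 i h

/-- **`w₁`, «the classical "discriminant"», is an isometry invariant: `l(∏ aᵢ) = l(∏ bᵢ)` in `k₁F`** (i.e. the
discriminants agree up to squares). [cite: Milnor1970, §3 (p0011 L15), Lemma 3.1 (p0011 L24–L26)] -/
theorem kl_prod_eq_of_diagIsometric (h2 : (2 : F) ≠ 0) {n : ℕ} {a b : Fin n → Fˣ}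
    (h : DiagIsometric (fun i => (a i : F)) (fun i => (b i : F))) :
    kl F (∏ i, a i) = kl F (∏ i, b i) := by
  rw [← List.prod_ofFn, ← List.prod_ofFn, ← swComp_one, ← swComp_one]
  exact swComp_eq_of_diagIsometric h2 1 h

/-- **`w₂`, «essentially equal to the classical Hasse-Witt invariant», is an isometry invariant.** [cite: Milnor1970, §3 (p0011 L15–L16), Lemma 3.1 (p0011 L24–L26)] -/
theorem swComp_two_eq_of_diagIsometric (h2 : (2 : F) ≠ 0) {n : ℕ} {a b : Fin n → Fˣ}
    (h : DiagIsometric (fun i => (a i : F)) (fun i => (b i : F))) :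
    swComp F 2 (List.ofFn a) = swComp F 2 (List.ofFn b) :=
  swComp_eq_of_diagIsometric h2 2 h

/-- LEMMA 3.1 with Mathlib's `QuadraticMap.Equivalent` of the weighted sums of squares. [cite: Milnor1970, §3 Lemma 3.1 (p0011 L24–L26)] -/
theorem swComp_eq_of_equivalent [NeZero (2 : F)] (i : ℕ) {n : ℕ} {a b : Fin n → Fˣ}
    (h : (weightedSumSquares F fun i => (a i : F)).Equivalent (weightedSumSquares F fun i => (b i : F))) :
    swComp F i (List.ofFn a) = swComp F i (List.ofFn b) :=
  swComp_eq_of_diagIsometric (NeZero.ne 2) i (diagIsometric_of_equivalent h)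

/-- LEMMA 3.1 for `sw` with Mathlib's `QuadraticMap.Equivalent`. [cite: Milnor1970, §3 Lemma 3.1 (p0011 L24–L26)] -/
theorem sw_eq_of_equivalent [NeZero (2 : F)] {n : ℕ} {a b : Fin n → Fˣ}
    (h : (weightedSumSquares F fun i => (a i : F)).Equivalent (weightedSumSquares F fun i => (b i : F))) :
    sw F (List.ofFn a) = sw F (List.ofFn b) :=
  sw_eq_of_diagIsometric (NeZero.ne 2) (diagIsometric_of_equivalent h)

/-! ### «Furthermore w(M ⊕ N) = w(M) w(N)» -/

/-- **`w(⟨a⟩ ⊥ ⟨b⟩) = w(⟨a⟩) w(⟨b⟩)`** (orthogonal sum = `Fin.append`). [cite: Milnor1970, §3 Lemma 3.1 «Furthermore w(M ⊕ N) = w(M) w(N)» (p0011 L26–L27)] -/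
theorem swSeries_diagClass_append {p q : ℕ} (a : Fin p → Fˣ) (b : Fin q → Fˣ) :
    swSeries F (diagClass (Fin.append a b)) = swSeries F (diagClass a) * swSeries F (diagClass b) := by
  rw [diagClass_append, swSeries_add]

/-- The same for g40's `sw`: `sw ⟨a ++ b⟩ = sw ⟨a⟩ · sw ⟨b⟩`. [cite: Milnor1970, §3 Lemma 3.1 (p0011 L26–L27)] -/
theorem sw_ofFn_append {p q : ℕ} (a : Fin p → Fˣ) (b : Fin q → Fˣ) :
    sw F (List.ofFn (Fin.append a b)) = sw F (List.ofFn a) * sw F (List.ofFn b) := by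
  rw [List.ofFn_fin_append, sw_append]

end MilnorKStar

end Field

end Literature.RingTheory.KTheory

end
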